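import Summits.QuantumFields.GaugeBoot.BootstrapReflections
import HarnessLib

/-!
# Lattice symmetries of the bootstrap V: the loop equations test function by test function, modulo the stabiliser (gauge-boot, L1 supplement)

HONEST FRAMING (cell `pub-gaugeboot`, page 1 of every file): the venture produces certified bounds
on lattice expectations at stated coupling, gauge group, dimension and torus size; NOT a mass gap,
NOT a continuum limit, NOT a string tension; NOT Yang–Mills-summit-bearing (barriers
`FixedCouplingUltralocality`, `PerturbativeInvisibility`). Structural; it certifies no number.

## Content

`BootstrapAxisPermutations` reduced the loop equations of a lattice-invariant functional to the ONE
base link `(0, 0)`. A practical bootstrap reduces further: at the base link it writes one equation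
per symmetry class of TEST FUNCTIONS under the stabiliser of the link. This file supplies the
bookkeeping, for any gauge group:

* `IsSDRow r k S β φ i a f` — the single loop equation at link `i`, direction `a`, test function `f`;
  `IsSDFunctionalAt.isSDRow`, `isSDFunctionalAt_of_isSDRow` (rows for all polynomial `f` ⇔ the
  tree's `IsSDFunctionalAt`);
* LINEARITY in the test function: `IsSDRow.add`, `IsSDRow.smul`, ★ `isSDRow_of_span` — rows for a
  family `𝓕` of polynomial test functions give the rows for every `f ∈ span 𝓕`;
* ★★ `IsSDRow.comp_of_fixing` — TRANSPORT: if a continuous self-map `R` of the configurations fixes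
  the link `i` as a left shift (`R (U[i ↦ g U_i]) = (R U)[i ↦ g (R U)_i]`) and preserves the local
  action `S i`, and `φ` is `R`-invariant on the polynomials, then the row for `f` gives
  the row for `f ∘ R`; instances: `relabelCM_update_of_fixed` (relabellings `π` with `π i = i`: axis
  permutations fixing the axis of the base link), `negReflect_update_base` (the reflection `Θ'` fixes
  the base links `(0, i₀)`, `i₀ ≠ 0`);
* ★★★ `isSDFunctionalAt_base_of_rows_suN` — `SU(N)`: for a functional invariant under the axis
  permutations fixing `i₀` and under `Θ'`, the loop equations at the base link `(0, i₀)` (`i₀ ≠ 0`)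
  for a family `𝓕` of test functions hold for every test function in the span of the orbit of `𝓕`
  under these symmetries; so if that span is all polynomials, `IsSDFunctionalAt {(0, i₀)}` holds —
  and with translation/permutation invariance all loop equations (`BootstrapAxisPermutations`).

What this is NOT: the REVERSAL of the base link (its transport goes through the right rows of
`RightShiftRows`, which mix test functions); rates.

References: V. Kazakov, Z. Zheng, arXiv:2203.11360 §3.2 (loop equations modulo lattice symmetry).
Folklore.
-/

noncomputable section

open MeasureTheory Filter Topology NormedSpace
open Literature.MathematicalPhysics.QuantumFieldTheory (LatticeRep Site Edge GaugeConfig wilsonAction edgePerm sitePerm)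

namespace Summit.QuantumFields.GaugeBoot

/-! ## Rows test function by test function -/

section Rows

variable {ι : Type*} [DecidableEq ι] {G : Type*} [Group G] [TopologicalSpace G] (r : LatticeRep G)
  {K : Type*} (k : K → ℝ → G) (S : ι → (ι → G) → ℝ) (β : ℝ) (φ : C(ι → G, ℝ) →ₗ[ℝ] ℝ)

/-- **The loop equation at link `i`, direction `a`, for the test function `f`**: for every polynomial
derivative `S'` of the local action and `f'` of `f` along `U ↦ U[i ↦ k_a(t) U_i]`,
`φ f' = β φ (f S')`. [shape] A parametric definition of a proposition — NOT a fact. [folklore] -/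
def IsSDRow (i : ι) (a : K) (f : C(ι → G, ℝ)) : Prop :=
  ∀ S' ∈ polyAlgebra (ι := ι) r, (∀ U, HasDerivAt (fun t => S i (Function.update U i (k a t * U i))) (S' U) 0) →
    ∀ f' ∈ polyAlgebra (ι := ι) r, (∀ U, HasDerivAt (fun t => f (Function.update U i (k a t * U i))) (f' U) 0) →
      φ f' = β * φ (f * S')

variable {r k S β φ}

/-- `IsSDFunctionalAt` gives every row at its links. -/
theorem IsSDFunctionalAt.isSDRow {E₀ : Set ι} (h : IsSDFunctionalAt r E₀ k S β φ) {i : ι} (hi : i ∈ E₀) (a : K)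
    {f : C(ι → G, ℝ)} (hf : f ∈ polyAlgebra (ι := ι) r) : IsSDRow r k S β φ i a f := by
  intro S' _ hS' f' hf'm hf'
  obtain ⟨S₀, hS₀m, hS₀, hrow⟩ := h i hi a
  have hSS : S' = S₀ := ContinuousMap.ext fun U => (hS' U).unique (hS₀ U)
  rw [hSS]
  exact hrow f hf f' hf'm hf'

/-- Conversely, rows for every polynomial test function (and SOME polynomial derivative of each local
action) give `IsSDFunctionalAt`. -/
theorem isSDFunctionalAt_of_isSDRow {E₀ : Set ι}
    (hS : ∀ i ∈ E₀, ∀ a : K, ∃ S' ∈ polyAlgebra (ι := ι) r,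
      ∀ U, HasDerivAt (fun t => S i (Function.update U i (k a t * U i))) (S' U) 0)
    (hrows : ∀ i ∈ E₀, ∀ (a : K), ∀ f ∈ polyAlgebra (ι := ι) r, IsSDRow r k S β φ i a f) :
    IsSDFunctionalAt r E₀ k S β φ := by
  intro i hi a
  obtain ⟨S', hS'm, hS'⟩ := hS i hi a
  exact ⟨S', hS'm, hS', fun f hf f' hf'm hf' => hrows i hi a f hf S' hS'm hS' f' hf'm hf'⟩

variable [ContinuousMul G] (hk : ∀ a s t, k a (s + t) = k a s * k a t)
  {X : K → Matrix (Fin r.N) (Fin r.N) ℂ} (hX : ∀ a t, r.ρ (k a t) = exp ((t : ℂ) • X a))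
include hk hX

/-- **Rows add.** -/
theorem IsSDRow.add {i : ι} {a : K} {f g : C(ι → G, ℝ)} (hf : f ∈ polyAlgebra (ι := ι) r)
    (hg : g ∈ polyAlgebra (ι := ι) r) (hrf : IsSDRow r k S β φ i a f) (hrg : IsSDRow r k S β φ i a g) :
    IsSDRow r k S β φ i a (f + g) := by
  intro S' hS'm hS' h' _ hh'
  obtain ⟨f', hf'm, hf'⟩ := exists_deriv_mem_polyAlgebra r (hk a) (hX a) i hf
  obtain ⟨g', hg'm, hg'⟩ := exists_deriv_mem_polyAlgebra r (hk a) (hX a) i hg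
  have hsum : h' = f' + g' := ContinuousMap.ext fun U => (hh' U).unique
    (((hf' U).add (hg' U)).congr_of_eventuallyEq (Eventually.of_forall fun t => rfl))
  rw [hsum, map_add, hrf S' hS'm hS' f' hf'm hf', hrg S' hS'm hS' g' hg'm hg', add_mul, map_add, mul_add]

/-- **Rows scale.** -/
theorem IsSDRow.smul {i : ι} {a : K} {f : C(ι → G, ℝ)} (hf : f ∈ polyAlgebra (ι := ι) r)
    (hrf : IsSDRow r k S β φ i a f) (c : ℝ) : IsSDRow r k S β φ i a (c • f) := by
  intro S' hS'm hS' h' _ hh'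
  obtain ⟨f', hf'm, hf'⟩ := exists_deriv_mem_polyAlgebra r (hk a) (hX a) i hf
  have hsc : h' = c • f' := ContinuousMap.ext fun U => (hh' U).unique
    (((hf' U).const_mul c).congr_of_eventuallyEq (Eventually.of_forall fun t => rfl))
  rw [hsc, map_smul, hrf S' hS'm hS' f' hf'm hf', smul_mul_assoc, map_smul, smul_eq_mul, smul_eq_mul]
  ring

omit [ContinuousMul G] hk hX in
/-- The zero test function. -/
theorem isSDRow_zero (i : ι) (a : K) : IsSDRow r k S β φ i a 0 := by
  intro S' _ _ h' _ hh'
  have h0 : h' = 0 := ContinuousMap.ext fun U => (hh' U).unique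
    ((hasDerivAt_const (0 : ℝ) (0 : ℝ)).congr_of_eventuallyEq (Eventually.of_forall fun t => rfl))
  rw [h0, zero_mul, map_zero, mul_zero]

/-- ★ **Rows for a family give rows for its span.** [folklore] -/
theorem isSDRow_of_span {i : ι} {a : K} {𝓕 : Set C(ι → G, ℝ)} (h𝓕 : 𝓕 ⊆ polyAlgebra (ι := ι) r)
    (hrows : ∀ f ∈ 𝓕, IsSDRow r k S β φ i a f) {f : C(ι → G, ℝ)} (hf : f ∈ Submodule.span ℝ 𝓕) :
    IsSDRow r k S β φ i a f := by
  have hpoly : Submodule.span ℝ 𝓕 ≤ Subalgebra.toSubmodule (polyAlgebra (ι := ι) r) := Submodule.span_le.2 h𝓕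
  induction hf using Submodule.span_induction with
  | mem f hf => exact hrows f hf
  | zero => exact isSDRow_zero i a
  | add f g hf hg ihf ihg => exact ihf.add hk hX (hpoly hf) (hpoly hg) ihg
  | smul c f hf ih => exact ih.smul hk hX (hpoly hf) c

/-! ## Transport under a symmetry fixing the link -/

/-- ★★ **Transport of a row along a symmetry fixing the link.** Let `R` be a continuous self-map of
the configurations which intertwines the left shift at `i` with itself and preserves the local
action `S i`, and under which `φ` is invariant on the polynomials. Then the loop equation
at `(i, a)` for `f` implies the one for `f ∘ R`. [folklore] -/
theorem IsSDRow.comp_of_fixing {i : ι} {a : K} (R : C(ι → G, ι → G))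
    (hR : ∀ (g : G) (U : ι → G), R (Function.update U i (g * U i)) = Function.update (R U) i (g * R U i))
    (hSR : ∀ U, S i (R U) = S i U)
    (hφR : ∀ g ∈ polyAlgebra (ι := ι) r, φ (g.comp R) = φ g)
    {f : C(ι → G, ℝ)} (hf : f ∈ polyAlgebra (ι := ι) r) (hrow : IsSDRow r k S β φ i a f) :
    IsSDRow r k S β φ i a (f.comp R) := by
  intro S' hS'm hS' F' hF'm hF'
  obtain ⟨f', hf'm, hf'⟩ := exists_deriv_mem_polyAlgebra r (hk a) (hX a) i hf
  -- the derivative of `f ∘ R` is `f' ∘ R`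
  have hFf : F' = f'.comp R := ContinuousMap.ext fun U => (hF' U).unique (by
    have h := hf' (R U)
    have hfun : (fun t => f (Function.update (R U) i (k a t * R U i))) =
        fun t => (f.comp R) (Function.update U i (k a t * U i)) := by
      funext t; rw [ContinuousMap.comp_apply, hR]
    rwa [hfun] at h)
  -- the derivative of `S i` is `R`-invariant
  have hSS : S'.comp R = S' := ContinuousMap.ext fun U => by
    have h1 := hS' (R U)
    have hfun : (fun t => S i (Function.update (R U) i (k a t * R U i))) =
        fun t => S i (Function.update U i (k a t * U i)) := by
      funext t; rw [← hR, hSR]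
    rw [hfun] at h1
    exact h1.unique (hS' U)
  rw [hFf, hφR f' hf'm, hrow S' hS'm hS' f' hf'm hf', ← hφR _ (Subalgebra.mul_mem _ hf hS'm)]
  congr 1
  conv_rhs => rw [← hSS]
  rfl

omit [ContinuousMul G] hk hX in
/-- **Relabellings fixing the link** intertwine its left shift with itself. -/
theorem relabelCM_update_of_fixed (π : ι ≃ ι) {i : ι} (hπ : π i = i) (g : G) (U : ι → G) :
    relabelCM (G := G) π (Function.update U i (g * U i)) =
      Function.update (relabelCM (G := G) π U) i (g * relabelCM (G := G) π U i) := by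
  have h := relabelCM_update (G := G) π U i (g * U i)
  rw [hπ] at h
  rw [h, relabelCM_apply, hπ]

end Rows

/-! ## The torus: the stabiliser of a base link -/

section Torus

variable {d L : ℕ} [NeZero d] {G : Type*} [Group G]

/-- The origin is fixed by the site reflection (local copy of `LoopClasses.negReflect_zero`, whose
module is not imported here). -/
private theorem site_negReflect_zero : (0 : Site d L).negReflect = 0 := by
  funext j
  by_cases hj : j = 0
  · subst hj; simp
  · simp [Literature.MathematicalPhysics.QuantumFieldTheory.WilsonSiteRP.negReflect_apply_of_ne _ hj]

/-- The reflection reads the base link `(0, i₀)`, `i₀ ≠ 0`, at itself. -/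
theorem reflEdge_base {i₀ : Fin d} (hi₀ : i₀ ≠ 0) : reflEdge (((0 : Site d L)), i₀) = ((0 : Site d L), i₀) := by
  unfold reflEdge
  rw [if_neg hi₀, site_negReflect_zero]

/-- ★ **The reflection fixes the base links `(0, i₀)`, `i₀ ≠ 0`, as left shifts.** -/
theorem negReflect_update_base [TopologicalSpace G] [IsTopologicalGroup G] {i₀ : Fin d} (hi₀ : i₀ ≠ 0) (g : G)
    (U : GaugeConfig d L G) :
    negReflectCM (G := G) (Function.update U (((0 : Site d L)), i₀) (g * U ((0 : Site d L), i₀))) =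
      Function.update (negReflectCM (G := G) U) ((0 : Site d L), i₀) (g * negReflectCM (G := G) U ((0 : Site d L), i₀)) := by
  have h := negReflect_update_carried U (i := (((0 : Site d L)), i₀)) hi₀ g
  rw [reflEdge_base hi₀] at h
  simpa only [negReflectCM_apply] using h

omit [NeZero d] in
/-- Axis permutations fixing the axis `i₀` fix the base link `(0, i₀)`. -/
theorem edgePerm_base_of_fixed (σ : Equiv.Perm (Fin d)) {i₀ : Fin d} (hσ : σ i₀ = i₀) :
    edgePerm σ (((0 : Site d L)), i₀) = ((0 : Site d L), i₀) := by
  rw [edgePerm_apply]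
  exact Prod.ext (funext fun j => by simp) hσ

end Torus

/-! ## `SU(N)`: rows at a base link modulo its stabiliser -/

section Unitary

open Literature.MathematicalPhysics.QuantumLattice (fundamentalLatticeRep fundamentalRep continuous_fundamentalRep)

variable {d L : ℕ} [NeZero d] [NeZero L] (N : ℕ) (β : ℝ)

/-- ★★★ **`SU(N)`: the loop equations at the base link `(0, i₀)` (`i₀ ≠ 0`) modulo its stabiliser.**
Let `φ` be invariant on the polynomials under the axis permutations fixing `i₀` and under the
reflection `Θ'`. If the loop equation at `((0, i₀), a)` holds for every test function of a family
`𝓕` of polynomials, it holds for every test function in the span of `𝓕 ∪ 𝓕 ∘ π_σ (σ i₀ = i₀) ∪ 𝓕 ∘ Θ'`. (Iterate for the whole orbit; if the span is all polynomials, all rows at the base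
link hold, hence — `isSDFunctional_of_latticeInvariant_oneLink` — all rows.) [folklore] -/
theorem isSDRow_base_of_family_suN {i₀ : Fin d} (hi₀ : i₀ ≠ 0) (a : SuGenerator N)
    {φ : C(GaugeConfig d L (Matrix.specialUnitaryGroup (Fin N) ℂ), ℝ) →ₗ[ℝ] ℝ}
    (hφp : ∀ (σ : Equiv.Perm (Fin d)), σ i₀ = i₀ → ∀ g ∈ polyAlgebra (ι := Edge d L) (fundamentalLatticeRep N),
      φ (g.comp (relabelCM (edgePerm σ))) = φ g)
    (hφr : ∀ g ∈ polyAlgebra (ι := Edge d L) (fundamentalLatticeRep N), φ (g.comp negReflectCM) = φ g)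
    {𝓕 : Set C(GaugeConfig d L (Matrix.specialUnitaryGroup (Fin N) ℂ), ℝ)}
    (h𝓕 : 𝓕 ⊆ polyAlgebra (ι := Edge d L) (fundamentalLatticeRep N))
    (hrows : ∀ f ∈ 𝓕, IsSDRow (fundamentalLatticeRep N) (suExp N) (fun _ => wilsonAction (fundamentalRep (Fin N))) β φ
      ((0 : Site d L), i₀) a f)
    {f : C(GaugeConfig d L (Matrix.specialUnitaryGroup (Fin N) ℂ), ℝ)}
    (hf : f ∈ Submodule.span ℝ (𝓕 ∪
      {g | ∃ σ : Equiv.Perm (Fin d), σ i₀ = i₀ ∧ ∃ g₀ ∈ 𝓕, g = g₀.comp (relabelCM (edgePerm (L := L) σ))} ∪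
      {g | ∃ g₀ ∈ 𝓕, g = g₀.comp negReflectCM})) :
    IsSDRow (fundamentalLatticeRep N) (suExp N) (fun _ => wilsonAction (fundamentalRep (Fin N))) β φ
      ((0 : Site d L), i₀) a f := by
  refine isSDRow_of_span (suExp_add N) (X := fun X : SuGenerator N => (X : Matrix (Fin N) (Fin N) ℂ)) (rho_suExp N)
    ?_ ?_ hf
  · rintro g ((hg | ⟨σ, -, g₀, hg₀, rfl⟩) | ⟨g₀, hg₀, rfl⟩)
    · exact h𝓕 hg
    · exact comp_relabelCM_mem_polyAlgebra _ _ (h𝓕 hg₀)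
    · exact comp_negReflectCM_mem_polyAlgebra _ (h𝓕 hg₀)
  · rintro g ((hg | ⟨σ, hσ, g₀, hg₀, rfl⟩) | ⟨g₀, hg₀, rfl⟩)
    · exact hrows g hg
    · exact (hrows g₀ hg₀).comp_of_fixing (suExp_add N) (X := fun X : SuGenerator N => (X : Matrix (Fin N) (Fin N) ℂ))
        (rho_suExp N) (relabelCM (edgePerm σ))
        (fun g U => relabelCM_update_of_fixed (edgePerm σ) (edgePerm_base_of_fixed σ hσ) g U)
        (fun U => wilsonAction_comp_edgePerm (fundamentalRep (Fin N)) (continuous_fundamentalRep _) σ U)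
        (hφp σ hσ) (h𝓕 hg₀)
    · exact (hrows g₀ hg₀).comp_of_fixing (suExp_add N) (X := fun X : SuGenerator N => (X : Matrix (Fin N) (Fin N) ℂ))
        (rho_suExp N) negReflectCM (fun g U => negReflect_update_base hi₀ g U)
        (fun U => Literature.MathematicalPhysics.QuantumFieldTheory.wilsonAction_negReflect_eq (fundamentalRep (Fin N))
          (continuous_fundamentalRep _) U)
        hφr (h𝓕 hg₀)

end Unitary

end Summit.QuantumFields.GaugeBoot

end
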